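import Summits.QuantumFields.QCD.Theorems.HeatSlicedQuarksSmallFieldUltracontractivityStubFreeKernelDecayAux1
import Summits.QuantumFields.QCD.Theorems.HeatSlicedQuarksSmallFieldUltracontractivityStubFreeKernelDecayAux2

/-!
# Pointwise decay of momentum differences of the free massive Wilson heat symbol
(helpers for stub `stub_freeKernelDecay` of line `point-centred-axial-parabolic`, crux
`Summit.QuantumFields.QCD.Theses.HeatSlicedQuarks.SmallFieldUltracontractivity`, item stmt-QuantumFields-8871)

For the symbol `h_m(k) = (m + Σ_ν w_ν)² + Σ_ν sin² θ_ν` (`w_ν = 1 − cos θ_ν`, `θ_ν = 2π k_ν.val / L`) of the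
free massive Wilson operator `D₁ᴴ D₁` on `(ℤ/L)⁴`:

* `symbol_split` — in ONE angle `θ_μ` the symbol is affine in `w_μ`:
  `h_m = (m + S)² + Q + 2(1 + m + S) w_μ`, `S = Σ_{ν ≠ μ} w_ν`, `Q = Σ_{ν ≠ μ} sin² θ_ν`;
  `sq_add_sum_le` — `m² + S ≤ (m + S)² + Q` on the mass window `m ≥ −1/2` (so the mass decay
  `e^{−σ m²}` and the Gaussians `e^{−σ w_ν}` of the frozen directions split off);
* `cexp_symbol_eq` — `e^{−σ h_m(k)} = e^{−σ((m+S)²+Q)} · exp (−σB (1 − cos θ_μ))`, `B = 2(1+m+S) ∈ [1, 20]`;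
* `norm_iterate_torusDiff_symbol_le` — the **pointwise bound**: for `0 ≤ σ ≤ L²`, `m ∈ [−1/2, 1]`,
  `‖a‖ ≤ 1` and a `k_μ`-independent weight `p`,
  `‖Δ_μⁿ [p · (1 − a e^{−iθ_μ}) · e^{−σ h_m}](k)‖ ≤ Cₙ ‖p(k)‖ (1+σ)^{n/2} L⁻ⁿ (‖1 − a‖ + 6‖a‖ (1+σ)^{-1/2})
  e^{−σ m²} e^{−σ S(k)} e^{−(σ/8) w_μ(k)}` with `Cₙ = n! e² (10π)ⁿ e^{10π²n²}`
  (freezing `stub_fkdTorusToolkit` + the windowed Cauchy estimate `stub_fkdSymbolWindow`);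
* `sum_weight_le`, `sum_norm_mul_weight_le` — the Gaussian weights `e^{−σS_μ(k)} e^{−(σ/8)w_μ(k)}` (and the
  same times `‖1 − conj χ_k(e_ν)‖`, `ν ≠ μ`, with the gain `(1+σ)^{-1/2}`) sum to `≤ (12L/√(1+σ))⁴`.

References: folklore; pure theorem file (no definitions).
-/

noncomputable section

namespace Summit.QuantumFields.QCD.Cruxes.SmallFieldUltracontractivity.PointCentredAxialParabolic

open Literature.Probability.LatticeModels (TorusSite torusChar)
open scoped ComplexConjugate

/-! ### Algebra of the symbol -/

/-- The frozen-direction weight sum lies in `[0, 8]` when every weight lies in `[0, 2]`. -/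
theorem sum_erase_nonneg_le {w : Fin 4 → ℝ} (hw0 : ∀ ν, 0 ≤ w ν) (hw2 : ∀ ν, w ν ≤ 2) (μ : Fin 4) :
    0 ≤ ∑ ν ∈ Finset.univ.erase μ, w ν ∧ ∑ ν ∈ Finset.univ.erase μ, w ν ≤ 8 := by
  refine ⟨Finset.sum_nonneg fun ν _ => hw0 ν, ?_⟩
  calc ∑ ν ∈ Finset.univ.erase μ, w ν ≤ ∑ ν, w ν :=
        Finset.sum_le_sum_of_subset_of_nonneg (Finset.erase_subset _ _) fun ν _ _ => hw0 ν
    _ ≤ ∑ _ν : Fin 4, (2 : ℝ) := Finset.sum_le_sum fun ν _ => hw2 ν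
    _ = 8 := by norm_num

/-- **Mass–momentum decoupling on the mass window**: for `m ≥ −1/2` and weights `w_ν ≥ 0`,
`m² + S ≤ (m + S)² + Σ_{ν ≠ μ} w_ν (2 − w_ν)`, `S = Σ_{ν ≠ μ} w_ν`
(since `Σ_{ν ≠ μ} w_ν² ≤ S²` and `2m + 1 ≥ 0`). -/
theorem sq_add_sum_le {w : Fin 4 → ℝ} (hw0 : ∀ ν, 0 ≤ w ν) {m : ℝ} (hm : -(1 / 2 : ℝ) ≤ m) (μ : Fin 4) :
    m ^ 2 + ∑ ν ∈ Finset.univ.erase μ, w ν ≤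
      (m + ∑ ν ∈ Finset.univ.erase μ, w ν) ^ 2 + ∑ ν ∈ Finset.univ.erase μ, w ν * (2 - w ν) := by
  set S := ∑ ν ∈ Finset.univ.erase μ, w ν with hS
  have hS0 : 0 ≤ S := Finset.sum_nonneg fun ν _ => hw0 ν
  have hsq : ∑ ν ∈ Finset.univ.erase μ, w ν ^ 2 ≤ S * S := by
    rw [hS, Finset.sum_mul]
    refine Finset.sum_le_sum fun ν hν => ?_
    rw [sq]
    exact mul_le_mul_of_nonneg_left (Finset.single_le_sum (fun ν' _ => hw0 ν') hν) (hw0 ν)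
  have hQ : ∑ ν ∈ Finset.univ.erase μ, w ν * (2 - w ν) =
      2 * S - ∑ ν ∈ Finset.univ.erase μ, w ν ^ 2 := by
    rw [hS, Finset.mul_sum, ← Finset.sum_sub_distrib]
    exact Finset.sum_congr rfl fun ν _ => by ring
  rw [hQ]
  nlinarith [mul_nonneg (by linarith : (0 : ℝ) ≤ 2 * m + 1) hS0]

/-- **One-angle form of the symbol**: if `s2 μ = w μ (2 − w μ)` then
`(m + Σ w)² + Σ s2 = (m + S)² + Q + 2 (1 + m + S) w_μ` with `S, Q` the sums over `ν ≠ μ`. -/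
theorem symbol_split (w s2 : Fin 4 → ℝ) (m : ℝ) (μ : Fin 4) (hs2 : s2 μ = w μ * (2 - w μ)) :
    (m + ∑ ν, w ν) ^ 2 + ∑ ν, s2 ν =
      (m + ∑ ν ∈ Finset.univ.erase μ, w ν) ^ 2 + ∑ ν ∈ Finset.univ.erase μ, s2 ν +
        2 * (1 + m + ∑ ν ∈ Finset.univ.erase μ, w ν) * w μ := by
  rw [← Finset.sum_erase_add _ w (Finset.mem_univ μ), ← Finset.sum_erase_add _ s2 (Finset.mem_univ μ),
    hs2]
  ring

/-- `sin² θ = (1 − cos θ)(2 − (1 − cos θ))`. -/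
theorem sin_sq_eq_w (θ : ℝ) : Real.sin θ ^ 2 = (1 - Real.cos θ) * (2 - (1 - Real.cos θ)) := by
  rw [Real.sin_sq]; ring

/-- Sums over the frozen directions do not see the `μ`-th momentum. -/
theorem sum_erase_comp_add_single {L : ℕ} (μ : Fin 4) (f : ZMod L → ℝ) (k : TorusSite 4 L) :
    ∑ ν ∈ Finset.univ.erase μ, f ((k + Pi.single μ (1 : ZMod L) : TorusSite 4 L) ν) =
      ∑ ν ∈ Finset.univ.erase μ, f (k ν) := by
  refine Finset.sum_congr rfl fun ν hν => ?_
  rw [Pi.add_apply, Pi.single_eq_of_ne (Finset.ne_of_mem_erase hν), add_zero]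

/-- The symbol factor is `2π`-periodic along the real axis. -/
theorem symbolFactor_periodic (a : ℂ) (β t : ℝ) :
    (1 - a * Complex.exp (-(Complex.I * ((t + 2 * Real.pi : ℝ) : ℂ)))) *
        Complex.exp (-(β : ℂ) * (1 - Complex.cos ((t + 2 * Real.pi : ℝ) : ℂ))) =
      (1 - a * Complex.exp (-(Complex.I * (t : ℂ)))) *
        Complex.exp (-(β : ℂ) * (1 - Complex.cos (t : ℂ))) := by
  have h1 : ((t + 2 * Real.pi : ℝ) : ℂ) = (t : ℂ) + 2 * Real.pi := by push_cast; ring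
  rw [h1, Complex.cos_add_two_pi]
  have h2 : Complex.exp (-(Complex.I * ((t : ℂ) + 2 * Real.pi))) = Complex.exp (-(Complex.I * (t : ℂ))) := by
    rw [show -(Complex.I * ((t : ℂ) + 2 * Real.pi)) = -(Complex.I * (t : ℂ)) - 2 * Real.pi * Complex.I by ring,
      Complex.exp_sub, Complex.exp_two_pi_mul_I, div_one]
  rw [h2]

/-- The windowed Cauchy estimate for a constant multiple of the symbol factor. -/
theorem norm_iteratedDeriv_const_mul_symbolFactor_le (c a : ℂ) {β : ℝ} (hβ : 0 ≤ β) (n : ℕ)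
    {θ t δ : ℝ} (h1 : θ ≤ t) (h2 : t ≤ θ + δ) :
    ‖iteratedDeriv n (fun ζ : ℂ => c * ((1 - a * Complex.exp (-(Complex.I * ζ))) *
        Complex.exp (-(β : ℂ) * (1 - Complex.cos ζ)))) (t : ℂ)‖ ≤
      ‖c‖ * ((n.factorial : ℝ) * Real.exp 2 * Real.sqrt (1 + β) ^ n *
        (‖1 - a‖ + 6 * ‖a‖ * (Real.sqrt (1 + β))⁻¹) *
        Real.exp (β * δ ^ 2 / 8) * Real.exp (-(β / 8 * (1 - Real.cos θ)))) := by
  rw [iteratedDeriv_const_mul_field, norm_mul]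
  exact mul_le_mul_of_nonneg_left (norm_iteratedDeriv_symbolFactor_le_window hβ a n h1 h2)
    (norm_nonneg c)

/-! ### The symbol in one angle -/

/-- **Factorisation of the free heat symbol along direction `μ`**:
`e^{−σ h_m(k)} = e^{−σ((m+S)²+Q)} · exp (−σB (1 − cos θ_μ(k)))` with `S, Q` the frozen sums and
`B = 2(1 + m + S)`. -/
theorem cexp_symbol_eq {L : ℕ} (m σ : ℝ) (μ : Fin 4) (k : TorusSite 4 L) :
    Complex.exp (-(σ : ℂ) * ((((m + ∑ ν : Fin 4, (1 - Real.cos (2 * Real.pi * (ZMod.val (k ν) : ℝ) / L))) ^ 2 + ∑ ν : Fin 4, Real.sin (2 * Real.pi * (ZMod.val (k ν) : ℝ) / L) ^ 2) : ℝ) : ℂ)) =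
      ((Real.exp (-(σ * ((m + (∑ ν ∈ Finset.univ.erase μ, (1 - Real.cos (2 * Real.pi * (ZMod.val (k ν) : ℝ) / L)))) ^ 2 + (∑ ν ∈ Finset.univ.erase μ, Real.sin (2 * Real.pi * (ZMod.val (k ν) : ℝ) / L) ^ 2)))) : ℝ) : ℂ) *
        Complex.exp (-((σ * (2 * (1 + m + (∑ ν ∈ Finset.univ.erase μ, (1 - Real.cos (2 * Real.pi * (ZMod.val (k ν) : ℝ) / L))))) : ℝ) : ℂ) * (1 - Complex.cos ((2 * Real.pi * (ZMod.val (k μ) : ℝ) / L : ℝ) : ℂ))) := by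
  have hid := symbol_split (fun ν => (1 - Real.cos (2 * Real.pi * (ZMod.val (k ν) : ℝ) / L)))
    (fun ν => Real.sin (2 * Real.pi * (ZMod.val (k ν) : ℝ) / L) ^ 2) m μ (sin_sq_eq_w _)
  have hre : -(σ * ((m + ∑ ν : Fin 4, (1 - Real.cos (2 * Real.pi * (ZMod.val (k ν) : ℝ) / L))) ^ 2 + ∑ ν : Fin 4, Real.sin (2 * Real.pi * (ZMod.val (k ν) : ℝ) / L) ^ 2)) =
      -(σ * ((m + (∑ ν ∈ Finset.univ.erase μ, (1 - Real.cos (2 * Real.pi * (ZMod.val (k ν) : ℝ) / L)))) ^ 2 + (∑ ν ∈ Finset.univ.erase μ, Real.sin (2 * Real.pi * (ZMod.val (k ν) : ℝ) / L) ^ 2))) +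
        (-(σ * (2 * (1 + m + (∑ ν ∈ Finset.univ.erase μ, (1 - Real.cos (2 * Real.pi * (ZMod.val (k ν) : ℝ) / L)))))) * (1 - Real.cos (2 * Real.pi * (ZMod.val (k μ) : ℝ) / L))) := by
    rw [hid]; ring
  rw [← Complex.ofReal_cos, Complex.ofReal_exp, ← Complex.exp_add]
  congr 1
  have e1 : -(σ : ℂ) * ((((m + ∑ ν : Fin 4, (1 - Real.cos (2 * Real.pi * (ZMod.val (k ν) : ℝ) / L))) ^ 2 + ∑ ν : Fin 4, Real.sin (2 * Real.pi * (ZMod.val (k ν) : ℝ) / L) ^ 2) : ℝ) : ℂ) = ((-(σ * ((m + ∑ ν : Fin 4, (1 - Real.cos (2 * Real.pi * (ZMod.val (k ν) : ℝ) / L))) ^ 2 + ∑ ν : Fin 4, Real.sin (2 * Real.pi * (ZMod.val (k ν) : ℝ) / L) ^ 2)) : ℝ) : ℂ) := by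
    push_cast; ring
  rw [e1, hre]
  push_cast
  ring

/-- Bounds on the one-angle data on the mass window: `0 ≤ S ≤ 8`, `1 ≤ B ≤ 20`, `0 ≤ w_μ`, and
`e^{−σ((m+S)²+Q)} ≤ e^{−σ m²} e^{−σ S}` for `σ ≥ 0`. -/
theorem symbol_data_bounds {L : ℕ} {m σ : ℝ} (hm : m ∈ Set.Icc (-(1 / 2 : ℝ)) 1) (hσ : 0 ≤ σ) (μ : Fin 4)
    (k : TorusSite 4 L) :
    0 ≤ (∑ ν ∈ Finset.univ.erase μ, (1 - Real.cos (2 * Real.pi * (ZMod.val (k ν) : ℝ) / L))) ∧ (∑ ν ∈ Finset.univ.erase μ, (1 - Real.cos (2 * Real.pi * (ZMod.val (k ν) : ℝ) / L))) ≤ 8 ∧ 0 ≤ (1 - Real.cos (2 * Real.pi * (ZMod.val (k μ) : ℝ) / L)) ∧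
    Real.exp (-(σ * ((m + (∑ ν ∈ Finset.univ.erase μ, (1 - Real.cos (2 * Real.pi * (ZMod.val (k ν) : ℝ) / L)))) ^ 2 + (∑ ν ∈ Finset.univ.erase μ, Real.sin (2 * Real.pi * (ZMod.val (k ν) : ℝ) / L) ^ 2)))) ≤ Real.exp (-(σ * m ^ 2)) * Real.exp (-(σ * (∑ ν ∈ Finset.univ.erase μ, (1 - Real.cos (2 * Real.pi * (ZMod.val (k ν) : ℝ) / L))))) := by
  have hw0 : ∀ ν : Fin 4, 0 ≤ (1 - Real.cos (2 * Real.pi * (ZMod.val (k ν) : ℝ) / L)) := fun ν =>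
    sub_nonneg.2 (Real.cos_le_one _)
  have hw2 : ∀ ν : Fin 4, (1 - Real.cos (2 * Real.pi * (ZMod.val (k ν) : ℝ) / L)) ≤ 2 := fun ν => by
    linarith [Real.neg_one_le_cos (2 * Real.pi * (ZMod.val (k ν) : ℝ) / L)]
  obtain ⟨hS0, hS8⟩ := sum_erase_nonneg_le hw0 hw2 μ
  have hkey := sq_add_sum_le hw0 hm.1 μ
  have hQ : (∑ ν ∈ Finset.univ.erase μ, Real.sin (2 * Real.pi * (ZMod.val (k ν) : ℝ) / L) ^ 2) =
      ∑ ν ∈ Finset.univ.erase μ, (1 - Real.cos (2 * Real.pi * (ZMod.val (k ν) : ℝ) / L)) *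
        (2 - (1 - Real.cos (2 * Real.pi * (ZMod.val (k ν) : ℝ) / L))) :=
    Finset.sum_congr rfl fun ν _ => sin_sq_eq_w _
  refine ⟨hS0, hS8, hw0 μ, ?_⟩
  rw [← Real.exp_add, Real.exp_le_exp, hQ]
  nlinarith [mul_le_mul_of_nonneg_left hkey hσ]

/-! ### The numerical post-processing (all data atomic) -/

/-- From the `β = σB` window bound at one momentum to the uniform form: `B = 2(1+m+S) ∈ [1, 20]` gives
`√(1+σB) ≤ 5√(1+σ)`, `(√(1+σB))⁻¹ ≤ (√(1+σ))⁻¹`, `e^{σB (2πn/L)²/8} ≤ e^{10π²n²}` (`σ ≤ L²`) and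
`e^{−(σB/8) w} ≤ e^{−(σ/8) w}`. -/
theorem numeric_step (n : ℕ) {L σ m S Q w : ℝ} (p a : ℂ) (hL : 0 < L) (hσ : 0 ≤ σ) (hσL : σ ≤ L ^ 2)
    (hm : m ∈ Set.Icc (-(1 / 2 : ℝ)) 1) (hS0 : 0 ≤ S) (hS8 : S ≤ 8) (hw0 : 0 ≤ w)
    (hC : Real.exp (-(σ * ((m + S) ^ 2 + Q))) ≤ Real.exp (-(σ * m ^ 2)) * Real.exp (-(σ * S))) :
    (2 * Real.pi / L) ^ n * (‖p * ((Real.exp (-(σ * ((m + S) ^ 2 + Q))) : ℝ) : ℂ)‖ *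
      ((n.factorial : ℝ) * Real.exp 2 * Real.sqrt (1 + (σ * (2 * (1 + m + S)))) ^ n * (‖1 - a‖ + 6 * ‖a‖ * (Real.sqrt (1 + (σ * (2 * (1 + m + S)))))⁻¹) * Real.exp ((σ * (2 * (1 + m + S))) * ((n : ℝ) * (2 * Real.pi / L)) ^ 2 / 8) * Real.exp (-((σ * (2 * (1 + m + S))) / 8 * w)))) ≤
      ((n.factorial : ℝ) * Real.exp 2 * (10 * Real.pi) ^ n * Real.exp (10 * Real.pi ^ 2 * (n : ℝ) ^ 2)) * ‖p‖ * (Real.sqrt (1 + σ) ^ n / (L : ℝ) ^ n) * (‖1 - a‖ + 6 * ‖a‖ * (Real.sqrt (1 + σ))⁻¹) * Real.exp (-(σ * m ^ 2)) * (Real.exp (-(σ * S)) * Real.exp (-(σ / 8 * w))) := by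
  have hπ := Real.pi_pos
  have hB1 : 1 ≤ (2 * (1 + m + S)) := by linarith [hm.1]
  have hB20 : (2 * (1 + m + S)) ≤ 20 := by linarith [hm.2]
  have hs : 0 < Real.sqrt (1 + σ) := Real.sqrt_pos.2 (by linarith)
  have hβσ : σ ≤ σ * (2 * (1 + m + S)) := by nlinarith
  have h5 : Real.sqrt (1 + σ * (2 * (1 + m + S))) ≤ 5 * Real.sqrt (1 + σ) := by
    rw [show (5 : ℝ) * Real.sqrt (1 + σ) = Real.sqrt (5 ^ 2 * (1 + σ)) by
      rw [Real.sqrt_mul' _ (by linarith), Real.sqrt_sq (by norm_num)]]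
    exact Real.sqrt_le_sqrt (by nlinarith)
  have hr : (Real.sqrt (1 + σ * (2 * (1 + m + S))))⁻¹ ≤ (Real.sqrt (1 + σ))⁻¹ :=
    inv_anti₀ hs (Real.sqrt_le_sqrt (by linarith))
  have hwin : Real.exp (σ * (2 * (1 + m + S)) * ((n : ℝ) * (2 * Real.pi / L)) ^ 2 / 8) ≤
      Real.exp (10 * Real.pi ^ 2 * (n : ℝ) ^ 2) := by
    rw [Real.exp_le_exp]
    have hσB : σ * (2 * (1 + m + S)) / L ^ 2 ≤ 20 := by
      rw [div_le_iff₀ (by positivity)]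
      nlinarith
    have hq : σ * (2 * (1 + m + S)) * ((n : ℝ) * (2 * Real.pi / L)) ^ 2 / 8 =
        σ * (2 * (1 + m + S)) / L ^ 2 * ((n : ℝ) ^ 2 * Real.pi ^ 2 / 2) := by
      field_simp
      ring
    rw [hq]
    nlinarith [sq_nonneg ((n : ℝ) * Real.pi)]
  have hgauss : Real.exp (-(σ * (2 * (1 + m + S)) / 8 * w)) ≤ Real.exp (-(σ / 8 * w)) := by
    rw [Real.exp_le_exp]; nlinarith [mul_nonneg hσ hw0]
  rw [norm_mul, Complex.norm_of_nonneg (Real.exp_pos _).le, div_pow]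
  calc (2 * Real.pi) ^ n / L ^ n * (‖p‖ * Real.exp (-(σ * ((m + S) ^ 2 + Q))) *
        ((n.factorial : ℝ) * Real.exp 2 * Real.sqrt (1 + σ * (2 * (1 + m + S))) ^ n *
          (‖1 - a‖ + 6 * ‖a‖ * (Real.sqrt (1 + σ * (2 * (1 + m + S))))⁻¹) *
          Real.exp (σ * (2 * (1 + m + S)) * ((n : ℝ) * (2 * Real.pi / L)) ^ 2 / 8) *
          Real.exp (-(σ * (2 * (1 + m + S)) / 8 * w))))
      ≤ (2 * Real.pi) ^ n / L ^ n * (‖p‖ * (Real.exp (-(σ * m ^ 2)) * Real.exp (-(σ * S))) *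
        ((n.factorial : ℝ) * Real.exp 2 * (5 * Real.sqrt (1 + σ)) ^ n *
          (‖1 - a‖ + 6 * ‖a‖ * (Real.sqrt (1 + σ))⁻¹) *
          Real.exp (10 * Real.pi ^ 2 * (n : ℝ) ^ 2) *
          Real.exp (-(σ / 8 * w)))) := by
        gcongr
    _ = _ := by
        rw [show (10 : ℝ) * Real.pi = 5 * (2 * Real.pi) by ring]
        simp only [mul_pow]
        ring

/-! ### From a one-angle representation to the pointwise bound -/

/-- Freezing + finite differences versus derivatives, packaged: if `F(k) = Φ_k(θ_μ(k))` with `Φ_k`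
independent of `k_μ`, `2π`-periodic and the restriction of an entire `e_k` whose `n`-th derivative is
bounded by `M(k)` on the window `[θ_μ(k), θ_μ(k) + n·2π/L]`, then `‖Δ_μⁿ F(k)‖ ≤ (2π/L)ⁿ M(k)`. -/
theorem norm_iterate_torusDiff_le_of_repr {L : ℕ} [NeZero L] (μ : Fin 4) (n : ℕ)
    (Φ : TorusSite 4 L → ℝ → ℂ) (hind : ∀ k, Φ (k + Pi.single μ 1) = Φ k)
    (hper : ∀ k t, Φ k (t + 2 * Real.pi) = Φ k t)
    (e : TorusSite 4 L → ℂ → ℂ) (hΦe : ∀ k s, Φ k s = e k (s : ℂ)) (he : ∀ k, Differentiable ℂ (e k))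
    (M : TorusSite 4 L → ℝ)
    (hM : ∀ (k : TorusSite 4 L) (t : ℝ), (2 * Real.pi * (ZMod.val (k μ) : ℝ) / L) ≤ t →
      t ≤ (2 * Real.pi * (ZMod.val (k μ) : ℝ) / L) + n * (2 * Real.pi / L) → ‖iteratedDeriv n (e k) t‖ ≤ M k)
    (k : TorusSite 4 L) :
    ‖((fun (G : TorusSite 4 L → ℂ) (k : TorusSite 4 L) => G k - G (k + Pi.single μ 1))^[n] (fun k => Φ k (2 * Real.pi * (ZMod.val (k μ) : ℝ) / L))) k‖ ≤ (2 * Real.pi / L) ^ n * M k := by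
  have hL : (0 : ℝ) < L := by exact_mod_cast Nat.pos_of_ne_zero (NeZero.ne L)
  rw [iterate_torusDiff_eq_iterate_fwdDiff μ n Φ hind hper k]
  have hfun : Φ k = fun s : ℝ => e k (s : ℂ) := funext (hΦe k)
  rw [hfun]
  exact norm_iterate_fwdDiff_le (by positivity) n (e k) (he k) _ (M k) (hM k)

section Pointwise

variable {L : ℕ} [NeZero L]

omit [NeZero L] in
/-- The one-angle family is blind to the `μ`-th momentum when the weight `p` is. -/
theorem repr_shift_invariant (m σ : ℝ) (μ : Fin 4) (a : ℂ) (p : TorusSite 4 L → ℂ)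
    (hp : ∀ k, p (k + Pi.single μ 1) = p k) (k : TorusSite 4 L) :
    (fun (k : TorusSite 4 L) (t : ℝ) => (p k * ((Real.exp (-(σ * ((m + (∑ ν ∈ Finset.univ.erase μ, (1 - Real.cos (2 * Real.pi * (ZMod.val (k ν) : ℝ) / L)))) ^ 2 + (∑ ν ∈ Finset.univ.erase μ, Real.sin (2 * Real.pi * (ZMod.val (k ν) : ℝ) / L) ^ 2)))) : ℝ) : ℂ)) * ((1 - a * Complex.exp (-(Complex.I * (t : ℂ)))) * Complex.exp (-((σ * (2 * (1 + m + (∑ ν ∈ Finset.univ.erase μ, (1 - Real.cos (2 * Real.pi * (ZMod.val (k ν) : ℝ) / L))))) : ℝ) : ℂ) * (1 - Complex.cos (t : ℂ))))) (k + Pi.single μ 1) = (fun (k : TorusSite 4 L) (t : ℝ) => (p k * ((Real.exp (-(σ * ((m + (∑ ν ∈ Finset.univ.erase μ, (1 - Real.cos (2 * Real.pi * (ZMod.val (k ν) : ℝ) / L)))) ^ 2 + (∑ ν ∈ Finset.univ.erase μ, Real.sin (2 * Real.pi * (ZMod.val (k ν) : ℝ) / L) ^ 2)))) : ℝ) : ℂ))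 * ((1 - a * Complex.exp (-(Complex.I * (t : ℂ)))) * Complex.exp (-((σ * (2 * (1 + m + (∑ ν ∈ Finset.univ.erase μ, (1 - Real.cos (2 * Real.pi * (ZMod.val (k ν) : ℝ) / L))))) : ℝ) : ℂ) * (1 - Complex.cos (t : ℂ))))) k := by
  have hS : (∑ ν ∈ Finset.univ.erase μ, (1 - Real.cos (2 * Real.pi * (ZMod.val ((k + Pi.single μ (1 : ZMod L) : TorusSite 4 L) ν) : ℝ) / L))) = (∑ ν ∈ Finset.univ.erase μ, (1 - Real.cos (2 * Real.pi * (ZMod.val (k ν) : ℝ) / L))) :=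
    sum_erase_comp_add_single μ (fun j => (1 - Real.cos (2 * Real.pi * (ZMod.val j : ℝ) / L))) k
  have hQ : (∑ ν ∈ Finset.univ.erase μ, Real.sin (2 * Real.pi * (ZMod.val ((k + Pi.single μ (1 : ZMod L) : TorusSite 4 L) ν) : ℝ) / L) ^ 2) = (∑ ν ∈ Finset.univ.erase μ, Real.sin (2 * Real.pi * (ZMod.val (k ν) : ℝ) / L) ^ 2) :=
    sum_erase_comp_add_single μ (fun j => Real.sin (2 * Real.pi * (ZMod.val j : ℝ) / L) ^ 2) k
  funext t
  simp only []
  rw [hp k, hS, hQ]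

omit [NeZero L] in
/-- The one-angle family is `2π`-periodic. -/
theorem repr_periodic (m σ : ℝ) (μ : Fin 4) (a : ℂ) (p : TorusSite 4 L → ℂ) (k : TorusSite 4 L) (t : ℝ) :
    (fun (k : TorusSite 4 L) (t : ℝ) => (p k * ((Real.exp (-(σ * ((m + (∑ ν ∈ Finset.univ.erase μ, (1 - Real.cos (2 * Real.pi * (ZMod.val (k ν) : ℝ) / L)))) ^ 2 + (∑ ν ∈ Finset.univ.erase μ, Real.sin (2 * Real.pi * (ZMod.val (k ν) : ℝ) / L) ^ 2)))) : ℝ) : ℂ)) * ((1 - a * Complex.exp (-(Complex.I * (t : ℂ)))) * Complex.exp (-((σ * (2 * (1 + m + (∑ ν ∈ Finset.univ.erase μ, (1 - Real.cos (2 * Real.pi * (ZMod.val (k ν) : ℝ) / L))))) : ℝ) : ℂ) * (1 - Complex.cos (t : ℂ))))) k (t + 2 * Real.pi) = (fun (k : TorusSite 4 L) (t : ℝ) => (p k * ((Real.exp (-(σ * ((m + (∑ ν ∈ Finset.univ.erase μ, (1 - Real.cos (2 * Real.pi * (ZMod.val (k ν) : ℝ) / L)))) ^ 2 + (∑ ν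 ∈ Finset.univ.erase μ, Real.sin (2 * Real.pi * (ZMod.val (k ν) : ℝ) / L) ^ 2)))) : ℝ) : ℂ)) * ((1 - a * Complex.exp (-(Complex.I * (t : ℂ)))) * Complex.exp (-((σ * (2 * (1 + m + (∑ ν ∈ Finset.univ.erase μ, (1 - Real.cos (2 * Real.pi * (ZMod.val (k ν) : ℝ) / L))))) : ℝ) : ℂ) * (1 - Complex.cos (t : ℂ))))) k t := by
  simp only []
  rw [symbolFactor_periodic]

/-- **Pointwise bound for momentum differences of the weighted free heat symbol.** For every `n`,
`L ≥ 1`, `m ∈ [−1/2, 1]`, `0 ≤ σ ≤ L²`, direction `μ`, `‖a‖ ≤ 1` and `k_μ`-independent weight `p`: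
`‖Δ_μⁿ [p (1 − a e^{−iθ_μ}) e^{−σ h_m}](k)‖ ≤
  n! e² (10π)ⁿ e^{10π²n²} · ‖p k‖ · (1+σ)^{n/2} L⁻ⁿ · (‖1 − a‖ + 6‖a‖(1+σ)^{−1/2}) · e^{−σm²} e^{−σS(k)} e^{−(σ/8) w_μ(k)}`. -/
theorem norm_iterate_torusDiff_symbol_le (n : ℕ) (m : ℝ) (hm : m ∈ Set.Icc (-(1 / 2 : ℝ)) 1)
    (σ : ℝ) (hσ : 0 ≤ σ) (hσL : σ ≤ (L : ℝ) ^ 2) (μ : Fin 4) (a : ℂ)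
    (p : TorusSite 4 L → ℂ) (hp : ∀ k, p (k + Pi.single μ 1) = p k) (k : TorusSite 4 L) :
      ‖((fun (G : TorusSite 4 L → ℂ) (k : TorusSite 4 L) => G k - G (k + Pi.single μ 1))^[n]
          (fun k => p k * (1 - a * Complex.exp (-(Complex.I * ((2 * Real.pi * (ZMod.val (k μ) : ℝ) / L : ℝ) : ℂ)))) * Complex.exp (-(σ : ℂ) * ((((m + ∑ ν : Fin 4, (1 - Real.cos (2 * Real.pi * (ZMod.val (k ν) : ℝ) / L))) ^ 2 + ∑ ν : Fin 4, Real.sin (2 * Real.pi * (ZMod.val (k ν) : ℝ) / L) ^ 2) : ℝ) : ℂ)))) k‖ ≤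
        ((n.factorial : ℝ) * Real.exp 2 * (10 * Real.pi) ^ n * Real.exp (10 * Real.pi ^ 2 * (n : ℝ) ^ 2)) * ‖p k‖ * (Real.sqrt (1 + σ) ^ n / (L : ℝ) ^ n) * (‖1 - a‖ + 6 * ‖a‖ * (Real.sqrt (1 + σ))⁻¹) * Real.exp (-(σ * m ^ 2)) * (Real.exp (-(σ * (∑ ν ∈ Finset.univ.erase μ, (1 - Real.cos (2 * Real.pi * (ZMod.val (k ν) : ℝ) / L))))) * Real.exp (-(σ / 8 * (1 - Real.cos (2 * Real.pi * (ZMod.val (k μ) : ℝ) / L))))) := by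
  have hL : (0 : ℝ) < L := by exact_mod_cast Nat.pos_of_ne_zero (NeZero.ne L)
  -- Step 1: the one-angle representation
  have hF : (fun k : TorusSite 4 L => p k * (1 - a * Complex.exp (-(Complex.I * ((2 * Real.pi * (ZMod.val (k μ) : ℝ) / L : ℝ) : ℂ)))) * Complex.exp (-(σ : ℂ) * ((((m + ∑ ν : Fin 4, (1 - Real.cos (2 * Real.pi * (ZMod.val (k ν) : ℝ) / L))) ^ 2 + ∑ ν : Fin 4, Real.sin (2 * Real.pi * (ZMod.val (k ν) : ℝ) / L) ^ 2) : ℝ) : ℂ))) =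
      fun k => (fun (k : TorusSite 4 L) (t : ℝ) => (p k * ((Real.exp (-(σ * ((m + (∑ ν ∈ Finset.univ.erase μ, (1 - Real.cos (2 * Real.pi * (ZMod.val (k ν) : ℝ) / L)))) ^ 2 + (∑ ν ∈ Finset.univ.erase μ, Real.sin (2 * Real.pi * (ZMod.val (k ν) : ℝ) / L) ^ 2)))) : ℝ) : ℂ)) * ((1 - a * Complex.exp (-(Complex.I * (t : ℂ)))) * Complex.exp (-((σ * (2 * (1 + m + (∑ ν ∈ Finset.univ.erase μ, (1 - Real.cos (2 * Real.pi * (ZMod.val (k ν) : ℝ) / L))))) : ℝ) : ℂ) * (1 - Complex.cos (t : ℂ))))) k (2 * Real.pi * (ZMod.val (k μ) : ℝ) / L) := by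
    funext k
    rw [cexp_symbol_eq m σ μ k]
    ring
  rw [hF]
  -- Step 2: the abstract bound and the numerics
  have hβ0 : ∀ k : TorusSite 4 L, 0 ≤ σ * (2 * (1 + m + (∑ ν ∈ Finset.univ.erase μ, (1 - Real.cos (2 * Real.pi * (ZMod.val (k ν) : ℝ) / L))))) := fun k =>
    mul_nonneg hσ (by linarith [(symbol_data_bounds hm hσ μ k).1, hm.1])
  obtain ⟨hS0, hS8, hw0, hC⟩ := symbol_data_bounds hm hσ μ k
  exact (norm_iterate_torusDiff_le_of_repr μ n (fun (k : TorusSite 4 L) (t : ℝ) => (p k * ((Real.exp (-(σ * ((m + (∑ ν ∈ Finset.univ.erase μ, (1 - Real.cos (2 * Real.pi * (ZMod.val (k ν) : ℝ) / L)))) ^ 2 + (∑ ν ∈ Finset.univ.erase μ, Real.sin (2 * Real.pi * (ZMod.val (k ν) : ℝ) / L) ^ 2)))) : ℝ) : ℂ)) * ((1 - a * Complex.exp (-(Complex.I * (t : ℂ)))) * Complex.exp (-((σ * (2 * (1 + m + (∑ ν ∈ Finset.univ.erase μ, (1 - Real.cos (2 * Real.pi * (ZMod.val (k ν) : ℝ)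 / L))))) : ℝ) : ℂ) * (1 - Complex.cos (t : ℂ)))))
    (repr_shift_invariant m σ μ a p hp) (repr_periodic m σ μ a p)
    (fun (k : TorusSite 4 L) (ζ : ℂ) => (p k * ((Real.exp (-(σ * ((m + (∑ ν ∈ Finset.univ.erase μ, (1 - Real.cos (2 * Real.pi * (ZMod.val (k ν) : ℝ) / L)))) ^ 2 + (∑ ν ∈ Finset.univ.erase μ, Real.sin (2 * Real.pi * (ZMod.val (k ν) : ℝ) / L) ^ 2)))) : ℝ) : ℂ)) * ((1 - a * Complex.exp (-(Complex.I * ζ))) * Complex.exp (-((σ * (2 * (1 + m + (∑ ν ∈ Finset.univ.erase μ, (1 - Real.cos (2 * Real.pi * (ZMod.val (k ν) : ℝ) / L))))) : ℝ) : ℂ) * (1 - Complex.cos ζ))))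
    (fun k s => rfl)
    (fun k => (differentiable_symbolFactor a _).const_mul _)
    (fun (k : TorusSite 4 L) => ‖p k * ((Real.exp (-(σ * ((m + (∑ ν ∈ Finset.univ.erase μ, (1 - Real.cos (2 * Real.pi * (ZMod.val (k ν) : ℝ) / L)))) ^ 2 + (∑ ν ∈ Finset.univ.erase μ, Real.sin (2 * Real.pi * (ZMod.val (k ν) : ℝ) / L) ^ 2)))) : ℝ) : ℂ)‖ * ((n.factorial : ℝ) * Real.exp 2 * Real.sqrt (1 + (σ * (2 * (1 + m + (∑ ν ∈ Finset.univ.erase μ, (1 - Real.cos (2 * Real.pi * (ZMod.val (k ν) : ℝ) / L))))))) ^ n * (‖1 - a‖ + 6 * ‖a‖ * (Real.sqrt (1 + (σ * (2 * (1 + m + (∑ ν ∈ Finset.univ.erase μ, (1 - Real.cos (2 * Real.pi * (ZMod.val (k ν) : ℝ) / L))))))))⁻¹) * Real.exp ((σ * (2 * (1 + m + (∑ ν ∈ Finset.univ.erase μ, (1 - Real.cos (2 * Real.pi * (ZMod.val (k ν) : ℝ) / L)))))) * ((n : ℝ) * (2 * Real.pi / L)) ^ 2 / 8) * Real.exp (-((σ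 * (2 * (1 + m + (∑ ν ∈ Finset.univ.erase μ, (1 - Real.cos (2 * Real.pi * (ZMod.val (k ν) : ℝ) / L)))))) / 8 * (1 - Real.cos (2 * Real.pi * (ZMod.val (k μ) : ℝ) / L))))))
    (fun k t h1 h2 => norm_iteratedDeriv_const_mul_symbolFactor_le _ a (hβ0 k) n h1 h2)
    k).trans (numeric_step n (p k) a hL hσ hσL hm hS0 hS8 hw0 hC)

end Pointwise

/-! ### Gaussian weight sums over the four-torus -/

section Sums

variable {L : ℕ}

/-- The product of the one-coordinate Gaussians is the Gaussian of the full weight sum. -/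
theorem prod_exp_eq (σ : ℝ) (k : TorusSite 4 L) :
    ∏ ν : Fin 4, Real.exp (-(σ / 8 * (1 - Real.cos (2 * Real.pi * (ZMod.val (k ν) : ℝ) / L)))) =
      Real.exp (-(σ / 8 * ∑ ν : Fin 4, (1 - Real.cos (2 * Real.pi * (ZMod.val (k ν) : ℝ) / L)))) := by
  rw [← Real.exp_sum, Finset.mul_sum, ← Finset.sum_neg_distrib]

/-- The four-torus sum of the product Gaussian: `Σ_k Π_ν ρ(k_ν) ≤ (12 L/√(1+σ))⁴` for `0 ≤ σ ≤ L²`. -/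
theorem sum_prod_exp_le [NeZero L] {σ : ℝ} (hσ : 0 ≤ σ) (hσL : σ ≤ (L : ℝ) ^ 2) :
    ∑ k : TorusSite 4 L, ∏ ν : Fin 4, Real.exp (-(σ / 8 * (1 - Real.cos (2 * Real.pi * (ZMod.val (k ν) : ℝ) / L)))) ≤
      (12 * L / Real.sqrt (1 + σ)) ^ 4 := by
  calc ∑ k : TorusSite 4 L, ∏ ν : Fin 4, Real.exp (-(σ / 8 * (1 - Real.cos (2 * Real.pi * (ZMod.val (k ν) : ℝ) / L))))
      = (∑ j : ZMod L, Real.exp (-(σ / 8 * (1 - Real.cos (2 * Real.pi * (ZMod.val j : ℝ) / L))))) ^ 4 :=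
        Summit.QuantumFields.QCD.Theorems.HeatSlicedQuarks.FreeKernel.sum_torus_prod_eq_pow
          (fun j : ZMod L => Real.exp (-(σ / 8 * (1 - Real.cos (2 * Real.pi * (ZMod.val j : ℝ) / L)))))
    _ ≤ (12 * L / Real.sqrt (1 + σ)) ^ 4 :=
        pow_le_pow_left₀ (Finset.sum_nonneg fun j _ => (Real.exp_pos _).le) (sum_zmod_exp_cos_le L hσ hσL) 4

/-- **Weight sum**: `Σ_k e^{−σ S_μ(k)} e^{−(σ/8) w_μ(k)} ≤ (12 L / √(1+σ))⁴`. -/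
theorem sum_weight_le [NeZero L] {σ : ℝ} (hσ : 0 ≤ σ) (hσL : σ ≤ (L : ℝ) ^ 2) (μ : Fin 4) :
    ∑ k : TorusSite 4 L, (Real.exp (-(σ * (∑ ν ∈ Finset.univ.erase μ, (1 - Real.cos (2 * Real.pi * (ZMod.val (k ν) : ℝ) / L))))) * Real.exp (-(σ / 8 * (1 - Real.cos (2 * Real.pi * (ZMod.val (k μ) : ℝ) / L))))) ≤ (12 * L / Real.sqrt (1 + σ)) ^ 4 := by
  refine le_trans (Finset.sum_le_sum fun k _ => ?_) (sum_prod_exp_le hσ hσL)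
  rw [prod_exp_eq, ← Real.exp_add, Real.exp_le_exp,
    ← Finset.sum_erase_add _ _ (Finset.mem_univ μ)]
  have hS0 : 0 ≤ (∑ ν ∈ Finset.univ.erase μ, (1 - Real.cos (2 * Real.pi * (ZMod.val (k ν) : ℝ) / L))) :=
    Finset.sum_nonneg fun ν _ => sub_nonneg.2 (Real.cos_le_one _)
  have hw0 : 0 ≤ (1 - Real.cos (2 * Real.pi * (ZMod.val (k μ) : ℝ) / L)) := sub_nonneg.2 (Real.cos_le_one _)
  nlinarith [mul_nonneg hσ hS0]

/-- **Weight sum with the square-root gain**: for `ν ≠ μ`,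
`Σ_k ‖1 − conj χ_k(e_ν)‖ e^{−σ S_μ(k)} e^{−(σ/8) w_μ(k)} ≤ 4 (√(1+σ))⁻¹ (12 L / √(1+σ))⁴`. -/
theorem sum_norm_mul_weight_le [NeZero L] {σ : ℝ} (hσ : 0 ≤ σ) (hσL : σ ≤ (L : ℝ) ^ 2) {μ ν : Fin 4} (hνμ : ν ≠ μ) :
    ∑ k : TorusSite 4 L, ‖1 - conj (torusChar k (Pi.single ν 1))‖ * (Real.exp (-(σ * (∑ ν ∈ Finset.univ.erase μ, (1 - Real.cos (2 * Real.pi * (ZMod.val (k ν) : ℝ) / L))))) * Real.exp (-(σ / 8 * (1 - Real.cos (2 * Real.pi * (ZMod.val (k μ) : ℝ) / L))))) ≤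
      4 * (Real.sqrt (1 + σ))⁻¹ * (12 * L / Real.sqrt (1 + σ)) ^ 4 := by
  have hs : 0 < Real.sqrt (1 + σ) := Real.sqrt_pos.2 (by linarith)
  -- pointwise: `‖1 − conj χ_k(e_ν)‖ · G(k) ≤ 4 (√(1+σ))⁻¹ Π_λ ρ(k_λ)`
  have hpt : ∀ k : TorusSite 4 L, ‖1 - conj (torusChar k (Pi.single ν 1))‖ * (Real.exp (-(σ * (∑ ν ∈ Finset.univ.erase μ, (1 - Real.cos (2 * Real.pi * (ZMod.val (k ν) : ℝ) / L))))) * Real.exp (-(σ / 8 * (1 - Real.cos (2 * Real.pi * (ZMod.val (k μ) : ℝ) / L))))) ≤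
      4 * ((Real.sqrt (1 + σ))⁻¹ * ∏ ν : Fin 4, Real.exp (-(σ / 8 * (1 - Real.cos (2 * Real.pi * (ZMod.val (k ν) : ℝ) / L))))) := by
    intro k
    rw [norm_one_sub_conj_torusChar_single, prod_exp_eq, ← Finset.sum_erase_add _ _ (Finset.mem_univ μ)]
    have hw0 : ∀ ν' : Fin 4, 0 ≤ (1 - Real.cos (2 * Real.pi * (ZMod.val (k ν') : ℝ) / L)) := fun ν' =>
      sub_nonneg.2 (Real.cos_le_one _)
    have hw2 : (1 - Real.cos (2 * Real.pi * (ZMod.val (k ν) : ℝ) / L)) ≤ 2 := by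
      linarith [Real.neg_one_le_cos (2 * Real.pi * (ZMod.val (k ν) : ℝ) / L)]
    have hνS : (1 - Real.cos (2 * Real.pi * (ZMod.val (k ν) : ℝ) / L)) ≤ (∑ ν ∈ Finset.univ.erase μ, (1 - Real.cos (2 * Real.pi * (ZMod.val (k ν) : ℝ) / L))) :=
      Finset.single_le_sum (fun ν' _ => hw0 ν') (Finset.mem_erase.2 ⟨hνμ, Finset.mem_univ ν⟩)
    have hS0 : 0 ≤ (∑ ν ∈ Finset.univ.erase μ, (1 - Real.cos (2 * Real.pi * (ZMod.val (k ν) : ℝ) / L))) := Finset.sum_nonneg fun ν' _ => hw0 ν'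
    have hgain : 2 * Real.sqrt ((1 - Real.cos (2 * Real.pi * (ZMod.val (k ν) : ℝ) / L)) / 2) ≤
        4 * Real.exp (σ * (1 - Real.cos (2 * Real.pi * (ZMod.val (k ν) : ℝ) / L)) / 8) * (Real.sqrt (1 + σ))⁻¹ := by
      rw [← div_eq_mul_inv, le_div_iff₀ hs]
      exact two_sqrt_mul_sqrt_le (hw0 ν) hw2 hσ
    calc 2 * Real.sqrt ((1 - Real.cos (2 * Real.pi * (ZMod.val (k ν) : ℝ) / L)) / 2) * (Real.exp (-(σ * (∑ ν ∈ Finset.univ.erase μ, (1 - Real.cos (2 * Real.pi * (ZMod.val (k ν) : ℝ) / L))))) * Real.exp (-(σ / 8 * (1 - Real.cos (2 * Real.pi * (ZMod.val (k μ) : ℝ) / L)))))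
        ≤ (4 * Real.exp (σ * (1 - Real.cos (2 * Real.pi * (ZMod.val (k ν) : ℝ) / L)) / 8) * (Real.sqrt (1 + σ))⁻¹) * (Real.exp (-(σ * (∑ ν ∈ Finset.univ.erase μ, (1 - Real.cos (2 * Real.pi * (ZMod.val (k ν) : ℝ) / L))))) * Real.exp (-(σ / 8 * (1 - Real.cos (2 * Real.pi * (ZMod.val (k μ) : ℝ) / L))))) := by
          gcongr
      _ = 4 * ((Real.sqrt (1 + σ))⁻¹ *
            Real.exp (σ * (1 - Real.cos (2 * Real.pi * (ZMod.val (k ν) : ℝ) / L)) / 8 + -(σ * (∑ ν ∈ Finset.univ.erase μ, (1 - Real.cos (2 * Real.pi * (ZMod.val (k ν) : ℝ) / L)))) + -(σ / 8 * (1 - Real.cos (2 * Real.pi * (ZMod.val (k μ) : ℝ) / L))))) := by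
          rw [Real.exp_add, Real.exp_add]; ring
      _ ≤ 4 * ((Real.sqrt (1 + σ))⁻¹ *
            Real.exp (-(σ / 8 * ((∑ ν ∈ Finset.univ.erase μ, (1 - Real.cos (2 * Real.pi * (ZMod.val (k ν) : ℝ) / L))) + (1 - Real.cos (2 * Real.pi * (ZMod.val (k μ) : ℝ) / L)))))) := by
          gcongr
          nlinarith [mul_le_mul_of_nonneg_left hνS hσ, mul_nonneg hσ hS0]
  calc ∑ k : TorusSite 4 L, ‖1 - conj (torusChar k (Pi.single ν 1))‖ * (Real.exp (-(σ * (∑ ν ∈ Finset.univ.erase μ, (1 - Real.cos (2 * Real.pi * (ZMod.val (k ν) : ℝ) / L))))) * Real.exp (-(σ / 8 * (1 - Real.cos (2 * Real.pi * (ZMod.val (k μ) : ℝ) / L)))))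
      ≤ ∑ k : TorusSite 4 L, 4 * ((Real.sqrt (1 + σ))⁻¹ * ∏ ν : Fin 4, Real.exp (-(σ / 8 * (1 - Real.cos (2 * Real.pi * (ZMod.val (k ν) : ℝ) / L))))) :=
        Finset.sum_le_sum fun k _ => hpt k
    _ = 4 * ((Real.sqrt (1 + σ))⁻¹ * ∑ k : TorusSite 4 L, ∏ ν : Fin 4, Real.exp (-(σ / 8 * (1 - Real.cos (2 * Real.pi * (ZMod.val (k ν) : ℝ) / L))))) := by
        rw [Finset.mul_sum, Finset.mul_sum]
    _ ≤ 4 * ((Real.sqrt (1 + σ))⁻¹ * (12 * L / Real.sqrt (1 + σ)) ^ 4) := by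
        gcongr
        exact sum_prod_exp_le hσ hσL
    _ = 4 * (Real.sqrt (1 + σ))⁻¹ * (12 * L / Real.sqrt (1 + σ)) ^ 4 := by ring

end Sums

/-- **Registered sub-goal `stub_fkdSymbolPointwise`**: the pointwise bound for the `n`-th momentum
difference in direction `μ` of the weighted free massive Wilson heat symbol
`p(k) (1 − a e^{−iθ_μ(k)}) e^{−σ h_m(k)}` on `(ℤ/L)⁴` (export of `norm_iterate_torusDiff_symbol_le`),
together with the two Gaussian weight sums it is integrated against (`sum_weight_le`,
`sum_norm_mul_weight_le`). -/
theorem stub_fkdSymbolPointwise : (∀ (n : ℕ) (L : ℕ) [NeZero L] (m : ℝ), m ∈ Set.Icc (-(1 / 2 : ℝ)) 1 → ∀ (σ : ℝ), 0 ≤ σ → σ ≤ (L : ℝ) ^ 2 → ∀ (μ : Fin 4) (a : ℂ) (p : Literature.Probability.LatticeModels.TorusSite 4 L → ℂ), (∀ k, p (k + Pi.single μ 1) = p k) → ∀ (k : Literature.Probability.LatticeModels.TorusSite 4 L), ‖((fun (G : Literature.Probability.LatticeModels.TorusSite 4 L → ℂ) (k : Literature.Probability.LatticeModels.TorusSite 4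 L) => G k - G (k + Pi.single μ 1))^[n] (fun k => p k * (1 - a * Complex.exp (-(Complex.I * ((2 * Real.pi * (ZMod.val (k μ) : ℝ) / L : ℝ) : ℂ)))) * Complex.exp (-(σ : ℂ) * ((((m + ∑ ν : Fin 4, (1 - Real.cos (2 * Real.pi * (ZMod.val (k ν) : ℝ) / L))) ^ 2 + ∑ ν : Fin 4, Real.sin (2 * Real.pi * (ZMod.val (k ν) : ℝ) / L) ^ 2) : ℝ) : ℂ)))) k‖ ≤ ((n.factorial : ℝ) * Real.exp 2 * (10 * Real.pi) ^ n * Real.exp (10 * Real.pi ^ 2 * (n : ℝ) ^ 2)) * ‖p k‖ * (Real.sqrt (1 + σ) ^ n / (L : ℝ) ^ n) * (‖1 - a‖ + 6 * ‖a‖ * (Real.sqrt (1 + σ))⁻¹) * Real.exp (-(σ * m ^ 2)) * (Real.exp (-(σ * (∑ ν ∈ Finset.univ.erase μ, (1 - Real.cos (2 * Real.pi * (ZMod.val (k ν) : ℝ) / L))))) * Real.exp (-(σ / 8 * (1 - Real.cos (2 * Real.pi * (ZMod.val (k μ) : ℝ) / L)))))) ∧ (∀ (L : ℕ) [NeZero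 L] (σ : ℝ), 0 ≤ σ → σ ≤ (L : ℝ) ^ 2 → ∀ (μ : Fin 4), ∑ k : Literature.Probability.LatticeModels.TorusSite 4 L, (Real.exp (-(σ * (∑ ν ∈ Finset.univ.erase μ, (1 - Real.cos (2 * Real.pi * (ZMod.val (k ν) : ℝ) / L))))) * Real.exp (-(σ / 8 * (1 - Real.cos (2 * Real.pi * (ZMod.val (k μ) : ℝ) / L))))) ≤ (12 * L / Real.sqrt (1 + σ)) ^ 4) ∧ (∀ (L : ℕ) [NeZero L] (σ : ℝ), 0 ≤ σ → σ ≤ (L : ℝ) ^ 2 → ∀ (μ ν : Fin 4), ν ≠ μ → ∑ k : Literature.Probability.LatticeModels.TorusSite 4 L, ‖1 - conj (Literature.Probability.LatticeModels.torusChar k (Pi.single ν 1))‖ * (Real.exp (-(σ * (∑ ν ∈ Finset.univ.erase μ, (1 - Real.cos (2 * Real.pi * (ZMod.val (k ν) : ℝ) / L))))) * Real.exp (-(σ / 8 * (1 - Real.cos (2 * Real.pi * (ZMod.val (k μ) : ℝ) / L))))) ≤ 4 * (Real.sqrt (1 + σ))⁻¹ * (12 * L / Real.sqrt (1 + σ))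 ^ 4) :=
  ⟨fun n _ _ m hm σ hσ hσL μ a p hp k => norm_iterate_torusDiff_symbol_le n m hm σ hσ hσL μ a p hp k,
    fun _ _ _ hσ hσL μ => sum_weight_le hσ hσL μ,
    fun _ _ _ hσ hσL _ _ hνμ => sum_norm_mul_weight_le hσ hσL hνμ⟩

end Summit.QuantumFields.QCD.Cruxes.SmallFieldUltracontractivity.PointCentredAxialParabolic

end
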